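import Mathlib.Geometry.Euclidean.Angle.Unoriented.TriangleInequality
import Mathlib.Geometry.Euclidean.Volume.Measure
import Literature.Geometry.DiscreteGeometry.SolidAngleFraction
import Literature.Geometry.DiscreteGeometry.SphericalCapVolume
import Literature.Geometry.DiscreteGeometry.SphericalWedgeVolume
import Mathlib.Analysis.Convex.Measure
import HarnessLib

/-!
# The spherical isoperimetric (Lévy–Schmidt) and isodiametric inequalities on `S²`, and the
# Euclidean isoperimetric inequality for finite unions of balls in `ℝ³` — definitions and named facts

Topic `Literature/Geometry/DiscreteGeometry` (sibling of `SolidAngleFraction.lean`,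
`SphericalCapVolume.lean`).  Written for the venture `Summits/Ventures/Crystal3D` (cell `pub-crystal3d`),
whose surface-deficit bound `C(n) ≤ 6n − γ n^{2/3}` on the contact number of `n` unit balls sums a
per-ball exposed-area inequality against a global isoperimetric inequality; the three classical
inputs of that chain are vendored here AS PRINTED, as named facts (`def … : Prop`, D-0014), in the
tree's normalisation-free language of unit-ball volume fractions.

## Content

* `rayCone A` — the cone of nonzero vectors whose direction lies in `A ⊆ S²`;
  `sphereFraction A := ballFraction 0 (rayCone A)` — the normalised measure of a set of directions
  (`= area(A)/4π`; on Borel sets this is the normalised rotation-invariant measure `μ₂` of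
  Figiel–Lindenstrauss–Milman, and `(4π) · sphereFraction` is the solid angle; it agrees with
  Mathlib's cone measure `Measure.toSphere` up to the factor `volume (ball 0 1) · 3`).
* `sphCap a r` — the closed spherical cap `{x ∈ S² | ∠(a, x) ≤ r}` (geodesic ball of radius `r`);
  `sphNhd A ε` — the closed geodesic `ε`-neighbourhood of `A` inside `S²`;
  `AngDiamLE X D` — "the geodesic diameter of `X` is at most `D`".
* NAMED FACTS (statements only; each carries its locator):
  `Schmidt1948_sphericalIsoperimetric` (Lévy–Schmidt, in the form of Figiel–Lindenstrauss–Milman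
  1977, Thm 2.1, case `n = 3`, together with their remark that the `ε`-neighbourhood of a cap of
  radius `r` is the cap of radius `r + ε`), `BoroczkySagmeister2019_sphericalIsodiametric`
  (Böröczky–Sagmeister, Thm 1.2, case `S²`), `Federer1969_isoperimetricUnionBalls` (Federer 3.2.43
  with 3.2.39, specialised to finite unions of closed balls in `ℝ³`).
* PROVED API: monotonicity / range of `sphereFraction`, the neighbourhood of a larger set is
  larger, and the corollary of the Lévy–Schmidt fact actually used downstream
  (`Schmidt1948_sphericalIsoperimetric.cap_le_nhd`:
  `sphereFraction (sphCap a (r + ε)) ≤ sphereFraction (sphNhd A ε)`).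

## What is NOT here

No proof of the three facts (they are classical; discharging them is future librarian work); no
value of `sphereFraction (sphCap a r)` — Archimedes' `(1 − cos r)/2` is PROVED in
`SphericalCapVolume.lean` (`volume_capCone_div`) for the OPEN cone of half-angle `≤ π/2`, and the
closed-cap / obtuse-radius bookkeeping is left to the consumer (`-- TODO` below); no general-`n`
versions (`-- TODO(general form)` at each fact).

## References

* T. Figiel, J. Lindenstrauss, V. D. Milman, *The dimension of almost spherical sections of convex
  bodies*, Acta Math. 139 (1977) 53–94, Theorem 2.1 (p. 56) and the remark following it;
  attributing the inequality to E. Schmidt, Math. Nachr. 1 (1948) 81–157, and P. Lévy (1951).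
  [`FigielLindenstraussMilman1977`, `Schmidt1948`]
* K. J. Böröczky, Á. Sagmeister, *The isodiametric problem on the sphere and in the hyperbolic
  space*, Acta Math. Hungar. 160 (2020) 13–32 (arXiv:1812.09753), Theorem 1.2.
  [`BoroczkySagmeister2019`]
* H. Federer, *Geometric Measure Theory*, Springer 1969, §3.2.43 (isoperimetric inequality, upper
  Minkowski content) and §3.2.39 (Minkowski content = Hausdorff measure on closed rectifiable
  sets). [`Federer1969`]
-/

noncomputable section

namespace Literature.Geometry.DiscreteGeometry

open Real InnerProductGeometry Metric Set
open _root_.MeasureTheory _root_.MeasureTheory.Measure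

local notation "E3" => EuclideanSpace ℝ (Fin 3)

/-! ### Sets of directions and their normalised measure -/

/-- The **cone of rays over a set of directions** `A` (meant: `A ⊆ S²`): the nonzero vectors `x`
whose direction `‖x‖⁻¹ • x` belongs to `A`; the origin is excluded.  (Not to be confused with
`dirCone C y` of `ConeTiling.lean`, the cone of feasible directions of a set at a point.)
[folklore] -/
def rayCone (A : Set E3) : Set E3 := {x | x ≠ 0 ∧ ‖x‖⁻¹ • x ∈ A}

/-- `rayCone` is monotone (plumbing for `sphereFraction_mono`). [folklore] -/
private theorem rayCone_mono {A B : Set E3} (h : A ⊆ B) : rayCone A ⊆ rayCone B :=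
  fun _ hx => ⟨hx.1, h hx.2⟩

/-- The **normalised measure of a set of directions** `A ⊆ S²`: the fraction of the volume of the
unit ball lying in the cone over `A`, i.e. `area(A)/(4π)` — the rotation-invariant probability
measure `μ₂` of Figiel–Lindenstrauss–Milman on Borel sets, written without any surface-measure
normalisation (cf. `ballFraction`, `solidAngleFraction`, and Hales's `sol(C) = 3 vol(C ∩ B)`).
[cite: FigielLindenstraussMilman1977, §2 (p. 56: μ_{n-1} normalised by μ_{n-1}(S^{n-1}) = 1)] -/
def sphereFraction (A : Set E3) : ℝ := ballFraction (0 : E3) (rayCone A)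

/-- Unfolding `sphereFraction` to volumes (the cone measure of FLM's `μ₂`). [cite: FigielLindenstraussMilman1977, §2 (p. 56)] -/
theorem sphereFraction_eq (A : Set E3) :
    sphereFraction A =
      (volume (ball (0 : E3) 1 ∩ rayCone A)).toReal / (volume (ball (0 : E3) (1 : ℝ))).toReal :=
  rfl

/-- `0 ≤ sphereFraction A` (`μ₂` is a probability measure). [cite: FigielLindenstraussMilman1977, §2 (p. 56)] -/
theorem sphereFraction_nonneg (A : Set E3) : 0 ≤ sphereFraction A :=
  ballFraction_nonneg _ _

/-- `sphereFraction A ≤ 1` (`μ₂` is a probability measure). [cite: FigielLindenstraussMilman1977, §2 (p. 56)] -/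
theorem sphereFraction_le_one (A : Set E3) : sphereFraction A ≤ 1 :=
  ballFraction_le_one _ _

/-- `sphereFraction` is monotone under inclusion (`μ₂` is a measure; here outer-measure
monotonicity, no measurability needed). [cite: FigielLindenstraussMilman1977, §2 (p. 56)] -/
theorem sphereFraction_mono {A B : Set E3} (h : A ⊆ B) : sphereFraction A ≤ sphereFraction B := by
  rw [sphereFraction_eq, sphereFraction_eq]
  refine div_le_div_of_nonneg_right ?_ ENNReal.toReal_nonneg
  have htop : volume (ball (0 : E3) 1 ∩ rayCone B) ≠ ⊤ :=
    (lt_of_le_of_lt (measure_mono inter_subset_left) measure_ball_lt_top).ne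
  exact ENNReal.toReal_mono htop (measure_mono (inter_subset_inter_right _ (rayCone_mono h)))

/-! ### Caps, geodesic neighbourhoods, geodesic diameter -/

/-- The **closed spherical cap** of angular (geodesic) radius `r` about the direction of `a`:
unit vectors `x` with `∠(a, x) ≤ r` (Mathlib's unoriented angle `InnerProductGeometry.angle`,
which is the geodesic distance on `S²`).  For `r ≥ π` it is the whole sphere, for `r < 0` it is
empty. [cite: FigielLindenstraussMilman1977, §2 (p. 56: "caps … B(x₀, r) = {x ∈ S^{n-1}; d(x₀, x) ≤ r}")] -/
def sphCap (a : E3) (r : ℝ) : Set E3 := {x | ‖x‖ = 1 ∧ angle a x ≤ r}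

/-- Caps grow with the radius (they are the balls of the geodesic metric). [cite: FigielLindenstraussMilman1977, §2 (p. 56)] -/
theorem sphCap_mono (a : E3) {r s : ℝ} (h : r ≤ s) : sphCap a r ⊆ sphCap a s :=
  fun _ hx => ⟨hx.1, hx.2.trans h⟩

/-- A cap of radius `≥ π` is the whole unit sphere (the geodesic metric takes values in `[0, π]`,
FLM: "0 ≤ d(x, y) ≤ π"). [cite: FigielLindenstraussMilman1977, §2 (p. 56)] -/
theorem sphCap_of_pi_le (a : E3) {r : ℝ} (h : π ≤ r) : sphCap a r = {x | ‖x‖ = 1} :=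
  Set.ext fun x => ⟨fun hx => hx.1, fun hx => ⟨hx, (angle_le_pi a x).trans h⟩⟩

/-- The **closed geodesic `ε`-neighbourhood** of `A` inside the unit sphere: unit vectors within
angle `ε` of some point of `A` (for closed, hence compact, `A ⊆ S²` — the only case used — this is
FLM's `{x : d(x, A) ≤ ε}`, the infimum being attained). [cite: FigielLindenstraussMilman1977, §2 (p. 56: "A_ε = {x ∈ S^{n-1}; d(x, A) ≤ ε}")] -/
def sphNhd (A : Set E3) (ε : ℝ) : Set E3 := {x | ‖x‖ = 1 ∧ ∃ y ∈ A, angle x y ≤ ε}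

/-- Neighbourhoods are monotone in the set. [cite: FigielLindenstraussMilman1977, §2 (p. 56)] -/
theorem sphNhd_mono {A B : Set E3} (h : A ⊆ B) (ε : ℝ) : sphNhd A ε ⊆ sphNhd B ε :=
  fun _ hx => ⟨hx.1, by obtain ⟨y, hy, hxy⟩ := hx.2; exact ⟨y, h hy, hxy⟩⟩

/-- A set of unit vectors lies in each of its `ε`-neighbourhoods (`ε ≥ 0`). [cite: FigielLindenstraussMilman1977, §2 (p. 56)] -/
theorem subset_sphNhd {A : Set E3} (hA : A ⊆ {x | ‖x‖ = 1}) {ε : ℝ} (hε : 0 ≤ ε) :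
    A ⊆ sphNhd A ε := by
  intro x hx
  refine ⟨hA hx, x, hx, ?_⟩
  have hx0 : x ≠ 0 := by
    intro h0
    have h1 : ‖x‖ = 1 := hA hx
    rw [h0, norm_zero] at h1
    exact zero_ne_one h1
  rw [angle_self hx0]
  exact hε

/-- The easy half of FLM's remark "if `B` is the cap `B(x, r)` then `B_ε` is the cap
`B(x, r + ε)`": `B(x,r)_ε ⊆ B(x, r + ε)` (triangle inequality for angles; PROVED here, the other
inclusion is part of the named fact below). [cite: FigielLindenstraussMilman1977, remark after Theorem 2.1 (p. 56)] -/
theorem sphNhd_sphCap_subset (a : E3) (r ε : ℝ) : sphNhd (sphCap a r) ε ⊆ sphCap a (r + ε) := by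
  rintro x ⟨hx1, y, ⟨_, hay⟩, hxy⟩
  refine ⟨hx1, ?_⟩
  calc angle a x ≤ angle a y + angle y x := angle_le_angle_add_angle a y x
    _ ≤ r + ε := by rw [angle_comm y x]; exact add_le_add hay hxy

/-- **Geodesic diameter at most `D`**: any two points of `X` make an angle `≤ D`.
[cite: BoroczkySagmeister2019, §1 (diam = supremum of geodesic distances)] -/
def AngDiamLE (X : Set E3) (D : ℝ) : Prop := ∀ x ∈ X, ∀ y ∈ X, angle x y ≤ D

/-- `AngDiamLE` is antitone in the set (a subset has no larger diameter). [cite: BoroczkySagmeister2019, §1 and Theorem 1.2] -/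
theorem AngDiamLE.mono {X Y : Set E3} {D : ℝ} (h : AngDiamLE Y D) (hXY : X ⊆ Y) : AngDiamLE X D :=
  fun x hx y hy => h x (hXY hx) y (hXY hy)

/-! ### The three classical inputs, as named facts -/

/-- NAMED FACT — **the spherical isoperimetric inequality (P. Lévy, E. Schmidt) on `S²`**, case
`n = 3` of Figiel–Lindenstrauss–Milman's Theorem 2.1 COMBINED with the remark printed right after
it.  Theorem 2.1: "Let `A` be a closed subset of `S^{n−1}` and let `B` be a cap of `S^{n−1}` so
that `μ_{n−1}(A) = μ_{n−1}(B)`. Then for every `ε > 0`, `μ_{n−1}(A_ε) ≥ μ_{n−1}(B_ε)`"; remark: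
"Observe that if `B` is the cap `B(x, r)` then `B_ε` is the cap `B(x, r + ε)`."  Stated here as
the single inequality the two give together, `μ₂(B(a, r + ε)) ≤ μ₂(A_ε)`, with `μ₂` written as
`sphereFraction` (normalisation-free; when `r + ε ≥ π` the cap `B(a, r + ε)` is the whole sphere
and so is `B_ε`, so the printed theorem still yields the inequality), caps and neighbourhoods
closed and geodesic (`sphCap`, `sphNhd`).  The hypothesis `A.Nonempty` is IMPLICIT in the printed theorem
(for `A = ∅` and `B` = a one-point cap of measure `0` the printed sentence fails: `∅_ε = ∅` while
`B_ε` is a cap of positive measure — counterexample due to the reviewer of p318451, checked in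
Lean); with `A ≠ ∅` the case `r = 0` reads `μ₂(B(b, ε)) ≤ μ₂(A_ε)` for `b ∈ A` and is true.  FLM
prove Theorem 2.1 in their appendix (spherical symmetrisation) and attribute it to Schmidt 1948.
-- TODO(general form): `S^{n-1}` for all `n`; the `B_ε`-form with equality cases.
[cite: FigielLindenstraussMilman1977, Theorem 2.1 and the following remark (p. 56)] -/
def Schmidt1948_sphericalIsoperimetric : Prop :=
  ∀ (A : Set E3) (a : E3) (r ε : ℝ), A.Nonempty → IsClosed A → A ⊆ {x | ‖x‖ = 1} → ‖a‖ = 1 →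
    0 ≤ r → 0 < ε → sphereFraction A = sphereFraction (sphCap a r) →
      sphereFraction (sphCap a (r + ε)) ≤ sphereFraction (sphNhd A ε)

/-- NAMED FACT — **the spherical isodiametric inequality on `S²`** (Böröczky–Sagmeister,
Theorem 1.2, case `n = 2` of `S^n`): "If `D ∈ (0, π)` and `X ⊂ S^n` is measurable with
`diam X ≤ D`, then `V(X) ≤ V(B(z₀, D/2))`, and equality holds if and only if the closure of `X` is
a ball of radius `D/2`" — here the inequality half, with `V` written as `sphereFraction`, the
geodesic diameter bound as `AngDiamLE`, and the comparison cap `sphCap a (D/2)` about an arbitrary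
unit vector `a` (all caps of the same radius have the same measure).  Measurability is asked of
the cone `rayCone X ⊆ ℝ³` (for `X ⊆ S²` this is measurability of `X` in the sphere).
-- TODO(general form): `S^n`, the equality case, and the hyperbolic version of the same paper.
[cite: BoroczkySagmeister2019, Theorem 1.2] -/
def BoroczkySagmeister2019_sphericalIsodiametric : Prop :=
  ∀ (X : Set E3) (D : ℝ) (a : E3), X ⊆ {x | ‖x‖ = 1} → MeasurableSet (rayCone X) → 0 < D → D < π →
    AngDiamLE X D → ‖a‖ = 1 → sphereFraction X ≤ sphereFraction (sphCap a (D / 2))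

/-- NAMED FACT — **the isoperimetric inequality in `ℝ³` for a finite union of closed balls**:
the boundary of `U = ⋃ᵢ B̄(cᵢ, rᵢ)` has finite area and `area(∂U)³ ≥ 36π · vol(U)²`, i.e.
`area(∂U) ≥ (36π)^{1/3} vol(U)^{2/3}` (equality for one ball).  This is the case `n = 3`,
`S = U` of Federer's 3.2.43 — "If `S ⊂ ℝⁿ` and `𝓛ⁿ(Clos S) < ∞`, then
`𝓜*^{n−1}(Bdry S) ≥ n α(n)^{1/n} 𝓛ⁿ(Clos S)^{(n−1)/n}`" (`α(3) = 4π/3`, so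
`3 α(3)^{1/3} = (36π)^{1/3}`) — combined with his 3.2.39 — "If `W` is a closed `m` rectifiable
subset of `ℝⁿ`, then `𝓜^m(W) = 𝓗^m(W)`" — for the closed `2`-rectifiable set `W = ∂U` (a finite
union of compact pieces of spheres), whose area is written with Mathlib's Euclidean-normalised
Hausdorff measure `μHE[2]` (the one giving a flat disc area `π ρ²`,
`euclideanHausdorffMeasure_two_disc`).
-- TODO(general form): arbitrary `S` with the upper Minkowski content, all `n` (Federer 3.2.43),
-- and the finite-perimeter version 4.5.9 (31).
[cite: Federer1969, §3.2.43 and §3.2.39] -/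
def Federer1969_isoperimetricUnionBalls : Prop :=
  ∀ (ι : Type) [Fintype ι] (c : ι → E3) (r : ι → ℝ),
    μHE[2] (frontier (⋃ i, closedBall (c i) (r i))) ≠ ⊤ ∧
      36 * π * ((volume (⋃ i, closedBall (c i) (r i))).toReal) ^ 2 ≤
        ((μHE[2] (frontier (⋃ i, closedBall (c i) (r i)))).toReal) ^ 3

/-- **The form used downstream**: `(36π)^{1/3}`-free restatement
`vol(U)² ≤ area(∂U)³/(36π)` for a finite union of closed balls. [cite: Federer1969, §3.2.43] -/
theorem Federer1969_isoperimetricUnionBalls.volume_sq_le (h : Federer1969_isoperimetricUnionBalls)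
    {ι : Type} [Fintype ι] (c : ι → E3) (r : ι → ℝ) :
    ((volume (⋃ i, closedBall (c i) (r i))).toReal) ^ 2 ≤
      ((μHE[2] (frontier (⋃ i, closedBall (c i) (r i)))).toReal) ^ 3 / (36 * π) := by
  rw [le_div_iff₀ (by positivity)]
  have := (h ι c r).2
  linarith


/-! ### Archimedes: the measure of a cap, `sphereFraction (sphCap a r) = (1 − cos r)/2` -/

section CapFraction

open RealInnerProductSpace

/-- The cone of rays over the closed cap of radius `r ∈ [0, π]` about the unit vector `a` is the
closed quadratic cone `{x ≠ 0 | cos r · ‖x‖ ≤ ⟪a, x⟫}`. [cite: FigielLindenstraussMilman1977, §2 (p. 56)] -/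
theorem rayCone_sphCap {a : E3} (ha : ‖a‖ = 1) {r : ℝ} (hr0 : 0 ≤ r) (hrπ : r ≤ π) :
    rayCone (sphCap a r) = {x | x ≠ 0 ∧ cos r * ‖x‖ ≤ ⟪a, x⟫} := by
  ext x
  simp only [rayCone, sphCap, mem_setOf_eq]
  constructor
  · rintro ⟨hx0, -, hang⟩
    refine ⟨hx0, ?_⟩
    have hnx : 0 < ‖x‖ := norm_pos_iff.2 hx0
    rw [angle_smul_right_of_pos a x (inv_pos.2 hnx)] at hang
    have hcos : cos r ≤ cos (angle a x) :=
      (strictAntiOn_cos.le_iff_ge ⟨hr0, hrπ⟩ ⟨angle_nonneg a x, angle_le_pi a x⟩).2 hang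
    rw [cos_angle, ha, one_mul, le_div_iff₀ hnx] at hcos
    exact hcos
  · rintro ⟨hx0, hle⟩
    have hnx : 0 < ‖x‖ := norm_pos_iff.2 hx0
    refine ⟨hx0, ?_, ?_⟩
    · rw [norm_smul, norm_inv, norm_norm, inv_mul_cancel₀ hnx.ne']
    · rw [angle_smul_right_of_pos a x (inv_pos.2 hnx)]
      have hcos : cos r ≤ cos (angle a x) := by
        rw [cos_angle, ha, one_mul, le_div_iff₀ hnx]; exact hle
      exact (strictAntiOn_cos.le_iff_ge ⟨hr0, hrπ⟩ ⟨angle_nonneg a x, angle_le_pi a x⟩).1 hcos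

/-- The closed cone `{x | c‖x‖ ≤ ⟪a, x⟫}` is convex when `c ≥ 0`. [folklore] -/
private theorem convex_closedCone (a : E3) {c : ℝ} (hc : 0 ≤ c) :
    Convex ℝ {x : E3 | c * ‖x‖ ≤ ⟪a, x⟫} := by
  intro x hx y hy s t hs ht _
  simp only [mem_setOf_eq] at hx hy ⊢
  calc c * ‖s • x + t • y‖ ≤ c * (‖s • x‖ + ‖t • y‖) := by gcongr; exact norm_add_le _ _
    _ = s * (c * ‖x‖) + t * (c * ‖y‖) := by
        rw [norm_smul_of_nonneg hs, norm_smul_of_nonneg ht]; ring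
    _ ≤ s * ⟪a, x⟫ + t * ⟪a, y⟫ := by gcongr
    _ = ⟪a, s • x + t • y⟫ := by rw [inner_add_right, real_inner_smul_right, real_inner_smul_right]

/-- For `0 ≤ c < 1`, the points of the closed cone that are not in the open cone lie on its
frontier. [folklore] -/
private theorem mem_frontier_closedCone {a : E3} (ha : ‖a‖ = 1) {c : ℝ} (hc0 : 0 ≤ c)
    (hc1 : c < 1) {x : E3} (hxK : c * ‖x‖ ≤ ⟪a, x⟫) (hxO : ¬ c * ‖x‖ < ⟪a, x⟫) :
    x ∈ frontier {y : E3 | c * ‖y‖ ≤ ⟪a, y⟫} := by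
  have heq : c * ‖x‖ = ⟪a, x⟫ := le_antisymm hxK (not_lt.1 hxO)
  rw [frontier_eq_closure_inter_closure]
  refine ⟨subset_closure hxK, ?_⟩
  -- the points `x - t • a`, `t → 0+`, are outside the cone
  rw [mem_closure_iff_seq_limit]
  refine ⟨fun n : ℕ => x - (1 / ((n : ℝ) + 1)) • a, fun n => ?_, ?_⟩
  · simp only [mem_compl_iff, mem_setOf_eq, not_le]
    have ht : (0 : ℝ) < 1 / ((n : ℝ) + 1) := by positivity
    have h1 : ⟪a, x - (1 / ((n : ℝ) + 1)) • a⟫ = c * ‖x‖ - 1 / ((n : ℝ) + 1) := by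
      rw [inner_sub_right, real_inner_smul_right, real_inner_self_eq_norm_sq, ha, ← heq]; ring
    have h2 : ‖x‖ - 1 / ((n : ℝ) + 1) ≤ ‖x - (1 / ((n : ℝ) + 1)) • a‖ := by
      have := norm_sub_norm_le x ((1 / ((n : ℝ) + 1)) • a)
      rw [norm_smul_of_nonneg ht.le, ha, mul_one] at this
      linarith
    rw [h1]
    nlinarith [mul_le_mul_of_nonneg_left h2 hc0]
  · have h0 : Filter.Tendsto (fun n : ℕ => (1 / ((n : ℝ) + 1)) • a) Filter.atTop (nhds 0) := by
      rw [← zero_smul ℝ a]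
      exact tendsto_one_div_add_atTop_nhds_zero_nat.smul_const a
    simpa using tendsto_const_nhds.sub h0


/-- Acute cones: for `0 < c < 1` the closed and the open cone of parameter `c` have the same volume
inside the unit ball (their difference lies on the frontier of a convex set). [folklore] -/
private theorem volume_ball_inter_cone_of_pos {a : E3} (ha : ‖a‖ = 1) {c : ℝ} (hc0 : 0 < c)
    (hc1 : c < 1) :
    volume (ball (0 : E3) 1 ∩ {x : E3 | x ≠ 0 ∧ c * ‖x‖ ≤ ⟪a, x⟫}) = volume (capCone a c) := by
  apply le_antisymm
  · have hsub : ball (0 : E3) 1 ∩ {x : E3 | x ≠ 0 ∧ c * ‖x‖ ≤ ⟪a, x⟫} ⊆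
        capCone a c ∪ frontier {y : E3 | c * ‖y‖ ≤ ⟪a, y⟫} := by
      rintro x ⟨hxb, -, hxK⟩
      by_cases hlt : c * ‖x‖ < ⟪a, x⟫
      · exact Or.inl ⟨hlt, hxb⟩
      · exact Or.inr (mem_frontier_closedCone ha hc0.le hc1 hxK hlt)
    calc volume (ball (0 : E3) 1 ∩ {x : E3 | x ≠ 0 ∧ c * ‖x‖ ≤ ⟪a, x⟫})
        ≤ volume (capCone a c ∪ frontier {y : E3 | c * ‖y‖ ≤ ⟪a, y⟫}) := measure_mono hsub
      _ ≤ volume (capCone a c) + volume (frontier {y : E3 | c * ‖y‖ ≤ ⟪a, y⟫}) :=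
          measure_union_le _ _
      _ = volume (capCone a c) := by
          rw [(convex_closedCone a hc0.le).addHaar_frontier volume, add_zero]
  · refine measure_mono fun x hx => ⟨hx.2, ?_, hx.1.le⟩
    intro h0
    have h1 : c * ‖x‖ < ⟪a, x⟫ := hx.1
    rw [h0, norm_zero, mul_zero, inner_zero_right] at h1
    exact lt_irrefl _ h1

/-- The closed cone of parameter `c` about `a` is, inside the punctured unit ball, the complement
of the open cone of parameter `-c` about `-a` (used for obtuse radii, `c < 0`). [folklore] -/
private theorem volume_ball_inter_cone_of_neg (a : E3) (c : ℝ) :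
    volume (ball (0 : E3) 1 ∩ {x : E3 | x ≠ 0 ∧ c * ‖x‖ ≤ ⟪a, x⟫}) =
      volume (ball (0 : E3) 1) - volume (capCone (-a) (-c)) := by
  have hset : ball (0 : E3) 1 ∩ {x : E3 | x ≠ 0 ∧ c * ‖x‖ ≤ ⟪a, x⟫} =
      (ball (0 : E3) 1 \ {0}) \ capCone (-a) (-c) := by
    ext x
    constructor
    · rintro ⟨hb, hx0, hle⟩
      refine ⟨⟨hb, hx0⟩, fun hx => ?_⟩
      have h1 : -c * ‖x‖ < ⟪-a, x⟫ := hx.1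
      rw [inner_neg_left] at h1
      linarith
    · rintro ⟨⟨hb, hx0⟩, h⟩
      refine ⟨hb, hx0, ?_⟩
      by_contra hlt
      apply h
      refine ⟨?_, hb⟩
      show -c * ‖x‖ < ⟪-a, x⟫
      rw [inner_neg_left]
      linarith [lt_of_not_ge hlt]
  have hsub : capCone (-a) (-c) ⊆ ball (0 : E3) 1 \ {0} := by
    intro x hx
    refine ⟨hx.2, fun h0 => ?_⟩
    have h1 : -c * ‖x‖ < ⟪-a, x⟫ := hx.1
    rw [mem_singleton_iff] at h0
    rw [h0, norm_zero, mul_zero, inner_zero_right] at h1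
    exact lt_irrefl _ h1
  have hfin : volume (capCone (-a) (-c)) ≠ ⊤ :=
    (lt_of_le_of_lt (measure_mono fun x hx => hx.2) measure_ball_lt_top).ne
  rw [hset, measure_sdiff hsub (measurableSet_capCone _ _).nullMeasurableSet hfin,
    measure_sdiff_null (measure_singleton _)]

/-- The degenerate cone `{x | ‖x‖ ≤ ⟪a, x⟫}` (`c = 1`) lies in the line `ℝ ∙ a` and is null.
[folklore] -/
private theorem volume_ball_inter_cone_one {a : E3} (ha : ‖a‖ = 1) :
    volume (ball (0 : E3) 1 ∩ {x : E3 | x ≠ 0 ∧ 1 * ‖x‖ ≤ ⟪a, x⟫}) = 0 := by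
  have ha0 : a ≠ 0 := by
    intro h; rw [h, norm_zero] at ha; exact zero_ne_one ha
  have hsub : ball (0 : E3) 1 ∩ {x : E3 | x ≠ 0 ∧ 1 * ‖x‖ ≤ ⟪a, x⟫} ⊆ (ℝ ∙ a : Submodule ℝ E3) := by
    rintro x ⟨-, -, hle⟩
    rw [one_mul] at hle
    have hsq : ‖x - ‖x‖ • a‖ ^ 2 ≤ 0 := by
      rw [norm_sub_sq_real, real_inner_smul_right, norm_smul_of_nonneg (norm_nonneg x), ha, mul_one,
        real_inner_comm]
      nlinarith [norm_nonneg x]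
    have h0 : x - ‖x‖ • a = 0 := by
      rw [← norm_eq_zero]; nlinarith [norm_nonneg (x - ‖x‖ • a)]
    rw [SetLike.mem_coe, Submodule.mem_span_singleton]
    exact ⟨‖x‖, by rw [sub_eq_zero] at h0; exact h0.symm⟩
  have hne : (ℝ ∙ a : Submodule ℝ E3) ≠ ⊤ := by
    intro h
    have h1 := finrank_span_singleton (K := ℝ) ha0
    rw [h, finrank_top, finrank_euclideanSpace_fin] at h1
    omega
  exact measure_mono_null hsub (Measure.addHaar_submodule volume _ hne)

/-- **Archimedes' hat-box theorem as a fraction**: the closed spherical cap of angular radius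
`r ∈ [0, π]` has normalised measure `(1 − cos r)/2` (FLM's formula (2.1) for `n = 3`: the measure
of `B(x₀, r)` is `∫` of `cos^{n−2}`); acute radii by `volume_capCone` (the slicing computation of
`SphericalCapVolume.lean`), right angle by the half-space, obtuse radii by complement, `r = 0` by
the null line. [cite: FigielLindenstraussMilman1977, (2.1) (p. 56)] -/
theorem sphereFraction_sphCap {a : E3} (ha : ‖a‖ = 1) {r : ℝ} (hr0 : 0 ≤ r) (hrπ : r ≤ π) :
    sphereFraction (sphCap a r) = (1 - cos r) / 2 := by
  have hV := volume_ball_toReal_pos (E := E3)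
  have ha0 : a ≠ 0 := by
    intro h; rw [h, norm_zero] at ha; exact zero_ne_one ha
  rw [sphereFraction_eq, rayCone_sphCap ha hr0 hrπ]
  rcases lt_trichotomy (cos r) 0 with hneg | hzero | hpos
  · -- obtuse
    have hna : ‖-a‖ = 1 := by rw [norm_neg, ha]
    have hcap := volume_capCone_div hna (neg_pos.2 hneg) (by linarith [neg_one_le_cos r])
    rw [volume_ball_inter_cone_of_neg a (cos r),
      ENNReal.toReal_sub_of_le (measure_mono fun x hx => hx.2) measure_ball_lt_top.ne, sub_div,
      div_self hV.ne', hcap]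
    ring
  · -- right angle: a half-space
    have hset : ball (0 : E3) 1 ∩ {x : E3 | x ≠ 0 ∧ cos r * ‖x‖ ≤ ⟪a, x⟫} =
        ({x : E3 | 0 ≤ ⟪a, x⟫} ∩ ball (0 : E3) 1) \ {0} := by
      ext x
      simp only [hzero, zero_mul, mem_inter_iff, mem_setOf_eq, mem_sdiff, mem_singleton_iff]
      tauto
    rw [hset, measure_sdiff_null (measure_singleton _), volume_halfspace_inter_ball ha0, hzero,
      ENNReal.toReal_div]
    simp only [ENNReal.toReal_ofNat, sub_zero]
    rw [div_div, mul_comm, ← div_div, div_self hV.ne']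
  · rcases eq_or_lt_of_le (cos_le_one r) with hone | hlt1
    · -- r = 0: the null line
      rw [hone, volume_ball_inter_cone_one ha]
      simp
    · -- acute
      rw [volume_ball_inter_cone_of_pos ha hpos hlt1]
      exact volume_capCone_div ha hpos hlt1.le

/-- The whole sphere has normalised measure `1` (cap of radius `π`). [cite: FigielLindenstraussMilman1977, §2 (p. 56: μ_{n-1}(S^{n-1}) = 1)] -/
theorem sphereFraction_sphere : sphereFraction {x : E3 | ‖x‖ = 1} = 1 := by
  have ha : ‖(EuclideanSpace.single 0 1 : E3)‖ = 1 := by simp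
  rw [← sphCap_of_pi_le (EuclideanSpace.single 0 1 : E3) le_rfl, sphereFraction_sphCap ha pi_pos.le le_rfl,
    cos_pi]
  norm_num

end CapFraction

end Literature.Geometry.DiscreteGeometry

end
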